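import Summits.CriticalPhenomena.PercolationContinuityZ3.Theorems.PercNearOneGluingNoHeavyLowerTailIncStarDegreeTwoRootFibre
import HarnessLib

/-!
# Degree-two root, II: the mixed root fibre `RF11 ≥ 0` by Harris' inequality and a 64-pattern count

Support file for the Sahi programme (`--supports stmt-CriticalPhenomena-4575`, prover prim-sahi-p2 gen 29).  No definitions, no named facts, no
sorries; standard axioms.  Memo `run/shared/lean/prim/prim-sahi/FROM-prim-sahi-p2-gen29-ROOT-FIBRE-DICHOTOMY.md` §2, `prim-sahi-p2/PROOF-E3.md` §39.

With the dictionary of Part I (`IncStar.real_pin10_principal` & co.: at a root of degree two the pinned laws of `EdgeInduction.sahiE3_twoBond`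
are the root-set cluster laws `A, B, M` of `u`, `v`, `{u,v}` in `G − s`), the mixed root fibre of profile `(1,1)` is
`RF11 = 2M(W) + 4A(W) + 4B(W) − Σ_t (A(t)B(W∖t) + B(t)A(W∖t))`.  **`twoEdgeRF11_nonneg_of_degTwoRoot`: `RF11 ≥ 0`.**  Harris' inequality
(the root-set events are increasing) merges each two-copy product into one configuration, `A(t)B(W∖t) ≤ P(t ∈ C_u, W∖t ⊆ C_v)`, and the six
merged events satisfy the pointwise count `real_split_count`: on each of the 64 membership patterns of `(b,c,y)` in `C_u`, `C_v` the number of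
ordered splits is at most `2·[W ⊆ C_u ∪ C_v] + 4·[W ⊆ C_u] + 4·[W ⊆ C_v]`.  Hence `incStar_nonneg_of_degTwoRoot'`: at a root of degree two the
increasing star follows from the three pinned stars (IH), the four root-edge Bernstein forms of `G − s` (hRZ) and the mixed fibres
`RF12, RF21, RF22` (memo §2: `RF12, RF21` hold by exact certificates in the port/target algebra; `RF22` is open at degree 3).
-/

noncomputable section

namespace Summit.CriticalPhenomena.PercolationContinuityZ3.Theorems

namespace IncStar

open MeasureTheory Set Literature.Probability.Percolation Literature.Probability.LatticeModels EdgeInduction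
open Literature.Probability.Percolation.DecisionTree (ind ind_of_mem ind_of_not_mem ind_nonneg)
open scoped Classical

variable {n : ℕ}

/-! ### The mixed root fibre of profile `(1,1)` is nonnegative -/


/-- The counting inequality behind `RF11 ≥ 0`, at the level of probabilities: with `Eu t = {u ↔ t in sᶜ}`, `Ev t = {v ↔ t in sᶜ}`,
`Σ_t [P(Eu t ∩ Ev j ∩ Ev k) + P(Ev t ∩ Eu j ∩ Eu k)] ≤ 2·P(⋂_t (Eu t ∪ Ev t)) + 4·P(⋂_t Eu t) + 4·P(⋂_t Ev t)`
(pointwise on the 64 membership patterns, then summed against the product weight). [this work] -/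
theorem real_split_count (w : Sym2 (Fin n) → unitInterval) (Ub Uc Uy Vb Vc Vy : Set (BondConfig (Fin n))) :
    (prodBernoulli w).real (Ub ∩ (Vc ∩ Vy)) + (prodBernoulli w).real (Uc ∩ (Vb ∩ Vy)) +
        (prodBernoulli w).real (Uy ∩ (Vb ∩ Vc)) + (prodBernoulli w).real (Vb ∩ (Uc ∩ Uy)) +
        (prodBernoulli w).real (Vc ∩ (Ub ∩ Uy)) + (prodBernoulli w).real (Vy ∩ (Ub ∩ Uc)) ≤
      2 * (prodBernoulli w).real ((Ub ∪ Vb) ∩ (Uc ∪ Vc) ∩ (Uy ∪ Vy)) +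
        4 * (prodBernoulli w).real (Ub ∩ Uc ∩ Uy) + 4 * (prodBernoulli w).real (Vb ∩ Vc ∩ Vy) := by
  simp only [prodBernoulli_real_eq_sum_weight_ind, Finset.mul_sum, ← Finset.sum_add_distrib]
  refine Finset.sum_le_sum fun ω _ => ?_
  have hw0 : 0 ≤ BHK2006.weight (fun e => (w e : ℝ)) ω :=
    BHK2006.weight_nonneg (fun e => (w e).2.1) (fun e => (w e).2.2) ω
  have key : ind (Ub ∩ (Vc ∩ Vy)) ω + ind (Uc ∩ (Vb ∩ Vy)) ω + ind (Uy ∩ (Vb ∩ Vc)) ω +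
      ind (Vb ∩ (Uc ∩ Uy)) ω + ind (Vc ∩ (Ub ∩ Uy)) ω + ind (Vy ∩ (Ub ∩ Uc)) ω ≤
      2 * ind ((Ub ∪ Vb) ∩ (Uc ∪ Vc) ∩ (Uy ∪ Vy)) ω + 4 * ind (Ub ∩ Uc ∩ Uy) ω + 4 * ind (Vb ∩ Vc ∩ Vy) ω := by
    by_cases h1 : ω ∈ Ub <;> by_cases h2 : ω ∈ Uc <;> by_cases h3 : ω ∈ Uy <;>
      by_cases h4 : ω ∈ Vb <;> by_cases h5 : ω ∈ Vc <;> by_cases h6 : ω ∈ Vy <;>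
        simp [ind, Set.mem_inter_iff, Set.mem_union, h1, h2, h3, h4, h5, h6] <;> norm_num
  have := mul_le_mul_of_nonneg_left key hw0
  nlinarith [this]

/-- **THE MIXED ROOT FIBRE `RF11` IS NONNEGATIVE AT A ROOT OF DEGREE TWO.**  With `P^{ab} = P_{w[s(s,u)↦a][s(s,v)↦b]}` and the star events of
the targets `b, c, y ≠ s`: `twoEdgeRF11 = 3·trilin(P¹¹,P⁰⁰,P⁰⁰) + 6·trilin(P¹⁰,P⁰¹,P⁰⁰) ≥ 0`.  Proof: the `P⁰⁰`-terms vanish (root a.s. isolated),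
the dictionary turns the rest into `2M(W) + 4A(W) + 4B(W) − Σ_t(A(t)B(W∖t) + B(t)A(W∖t))` for the root-set cluster laws of `G − s`, Harris' inequality
merges each product into one configuration, and the counting inequality `real_split_count` concludes. [this work] -/
theorem twoEdgeRF11_nonneg_of_degTwoRoot (w : Sym2 (Fin n) → unitInterval) {s u v b c y : Fin n}
    (hus : u ≠ s) (hvs : v ≠ s) (huv : u ≠ v) (hb : b ≠ s) (hc : c ≠ s) (hy : y ≠ s)
    (hw : ∀ z : Fin n, z ≠ s → z ≠ u → z ≠ v → w s(s, z) = 0) :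
    0 ≤ twoEdgeRF11 w s(s, u) s(s, v) (openConn s b) (openConn s c) (openConn s y) := by
  -- notation for the root-set events of `G − s`
  set S : Set (Fin n) := ((({s} : Finset (Fin n)) : Set (Fin n)))ᶜ with hS
  set Ub : Set (BondConfig (Fin n)) := openConnIn S u b with hUb
  set Uc : Set (BondConfig (Fin n)) := openConnIn S u c with hUc
  set Uy : Set (BondConfig (Fin n)) := openConnIn S u y with hUy
  set Vb : Set (BondConfig (Fin n)) := openConnIn S v b with hVb
  set Vc : Set (BondConfig (Fin n)) := openConnIn S v c with hVc
  set Vy : Set (BondConfig (Fin n)) := openConnIn S v y with hVy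
  -- the `P⁰⁰` probabilities vanish
  have z1 : (pin₂ w s(s, u) s(s, v) 0 0).real (openConn s b) = 0 := by simpa using real_openConn_pin00 w hw hb Set.univ
  have z2 : (pin₂ w s(s, u) s(s, v) 0 0).real (openConn s c) = 0 := by simpa using real_openConn_pin00 w hw hc Set.univ
  have z3 : (pin₂ w s(s, u) s(s, v) 0 0).real (openConn s y) = 0 := by simpa using real_openConn_pin00 w hw hy Set.univ
  have z4 : (pin₂ w s(s, u) s(s, v) 0 0).real (openConn s b ∩ openConn s c ∩ openConn s y) = 0 := by
    rw [Set.inter_assoc]; exact real_openConn_pin00 w hw hb _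
  have z5 : (pin₂ w s(s, u) s(s, v) 0 0).real (openConn s b ∩ openConn s c) = 0 := real_openConn_pin00 w hw hb _
  have z6 : (pin₂ w s(s, u) s(s, v) 0 0).real (openConn s b ∩ openConn s y) = 0 := real_openConn_pin00 w hw hb _
  have z7 : (pin₂ w s(s, u) s(s, v) 0 0).real (openConn s c ∩ openConn s y) = 0 := real_openConn_pin00 w hw hc _
  -- the dictionary for the fifteen remaining atoms
  have ne1 : ∀ t : Fin n, t ≠ s → ({t} : Finset (Fin n)).Nonempty := fun t _ => Finset.singleton_nonempty t
  have hU1 : ∀ t : Fin n, t ≠ s → ∀ x ∈ ({t} : Finset (Fin n)), x ≠ s := by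
    intro t ht x hx; rw [Finset.mem_singleton] at hx; rw [hx]; exact ht
  have hU2 : ∀ t t' : Fin n, t ≠ s → t' ≠ s → ∀ x ∈ ({t, t'} : Finset (Fin n)), x ≠ s := by
    intro t t' ht ht' x hx
    rw [Finset.mem_insert, Finset.mem_singleton] at hx
    rcases hx with rfl | rfl
    · exact ht
    · exact ht'
  have hU3 : ∀ x ∈ ({b, c, y} : Finset (Fin n)), x ≠ s := by
    intro x hx
    rw [Finset.mem_insert, Finset.mem_insert, Finset.mem_singleton] at hx
    rcases hx with rfl | rfl | rfl
    · exact hb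
    · exact hc
    · exact hy
  -- singles
  have a1 : (pin₂ w s(s, u) s(s, v) 1 0).real (openConn s b) = (prodBernoulli w).real Ub := by
    have h := real_pin10_principal w hus hvs huv hw {b} (ne1 b hb) (hU1 b hb)
    rwa [rootFibre_biInter_single, rootFibre_biInter_single] at h
  have a2 : (pin₂ w s(s, u) s(s, v) 1 0).real (openConn s c) = (prodBernoulli w).real Uc := by
    have h := real_pin10_principal w hus hvs huv hw {c} (ne1 c hc) (hU1 c hc)
    rwa [rootFibre_biInter_single, rootFibre_biInter_single] at h
  have a3 : (pin₂ w s(s, u) s(s, v) 1 0).real (openConn s y) = (prodBernoulli w).real Uy := by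
    have h := real_pin10_principal w hus hvs huv hw {y} (ne1 y hy) (hU1 y hy)
    rwa [rootFibre_biInter_single, rootFibre_biInter_single] at h
  have b1 : (pin₂ w s(s, u) s(s, v) 0 1).real (openConn s b) = (prodBernoulli w).real Vb := by
    have h := real_pin01_principal w hus hvs huv hw {b} (ne1 b hb) (hU1 b hb)
    rwa [rootFibre_biInter_single, rootFibre_biInter_single] at h
  have b2 : (pin₂ w s(s, u) s(s, v) 0 1).real (openConn s c) = (prodBernoulli w).real Vc := by
    have h := real_pin01_principal w hus hvs huv hw {c} (ne1 c hc) (hU1 c hc)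
    rwa [rootFibre_biInter_single, rootFibre_biInter_single] at h
  have b3 : (pin₂ w s(s, u) s(s, v) 0 1).real (openConn s y) = (prodBernoulli w).real Vy := by
    have h := real_pin01_principal w hus hvs huv hw {y} (ne1 y hy) (hU1 y hy)
    rwa [rootFibre_biInter_single, rootFibre_biInter_single] at h
  -- pairs
  have a5 : (pin₂ w s(s, u) s(s, v) 1 0).real (openConn s b ∩ openConn s c) = (prodBernoulli w).real (Ub ∩ Uc) := by
    have h := real_pin10_principal w hus hvs huv hw {b, c} ⟨b, by simp⟩ (hU2 b c hb hc)
    rwa [rootFibre_biInter_pair, rootFibre_biInter_pair] at h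
  have a6 : (pin₂ w s(s, u) s(s, v) 1 0).real (openConn s b ∩ openConn s y) = (prodBernoulli w).real (Ub ∩ Uy) := by
    have h := real_pin10_principal w hus hvs huv hw {b, y} ⟨b, by simp⟩ (hU2 b y hb hy)
    rwa [rootFibre_biInter_pair, rootFibre_biInter_pair] at h
  have a7 : (pin₂ w s(s, u) s(s, v) 1 0).real (openConn s c ∩ openConn s y) = (prodBernoulli w).real (Uc ∩ Uy) := by
    have h := real_pin10_principal w hus hvs huv hw {c, y} ⟨c, by simp⟩ (hU2 c y hc hy)
    rwa [rootFibre_biInter_pair, rootFibre_biInter_pair] at h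
  have b5 : (pin₂ w s(s, u) s(s, v) 0 1).real (openConn s b ∩ openConn s c) = (prodBernoulli w).real (Vb ∩ Vc) := by
    have h := real_pin01_principal w hus hvs huv hw {b, c} ⟨b, by simp⟩ (hU2 b c hb hc)
    rwa [rootFibre_biInter_pair, rootFibre_biInter_pair] at h
  have b6 : (pin₂ w s(s, u) s(s, v) 0 1).real (openConn s b ∩ openConn s y) = (prodBernoulli w).real (Vb ∩ Vy) := by
    have h := real_pin01_principal w hus hvs huv hw {b, y} ⟨b, by simp⟩ (hU2 b y hb hy)
    rwa [rootFibre_biInter_pair, rootFibre_biInter_pair] at h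
  have b7 : (pin₂ w s(s, u) s(s, v) 0 1).real (openConn s c ∩ openConn s y) = (prodBernoulli w).real (Vc ∩ Vy) := by
    have h := real_pin01_principal w hus hvs huv hw {c, y} ⟨c, by simp⟩ (hU2 c y hc hy)
    rwa [rootFibre_biInter_pair, rootFibre_biInter_pair] at h
  -- triples
  have a4 : (pin₂ w s(s, u) s(s, v) 1 0).real (openConn s b ∩ openConn s c ∩ openConn s y) =
      (prodBernoulli w).real (Ub ∩ Uc ∩ Uy) := by
    have h := real_pin10_principal w hus hvs huv hw {b, c, y} ⟨b, by simp⟩ hU3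
    rwa [rootFibre_biInter_triple, rootFibre_biInter_triple] at h
  have b4 : (pin₂ w s(s, u) s(s, v) 0 1).real (openConn s b ∩ openConn s c ∩ openConn s y) =
      (prodBernoulli w).real (Vb ∩ Vc ∩ Vy) := by
    have h := real_pin01_principal w hus hvs huv hw {b, c, y} ⟨b, by simp⟩ hU3
    rwa [rootFibre_biInter_triple, rootFibre_biInter_triple] at h
  have m4 : (pin₂ w s(s, u) s(s, v) 1 1).real (openConn s b ∩ openConn s c ∩ openConn s y) =
      (prodBernoulli w).real ((Ub ∪ Vb) ∩ (Uc ∪ Vc) ∩ (Uy ∪ Vy)) := by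
    have h := real_pin11_principal w hus hvs huv hw {b, c, y} ⟨b, by simp⟩ hU3
    rwa [rootFibre_biInter_triple, rootFibre_biInter_triple] at h
  -- Harris merges (all events increasing under the product law)
  have hm : ∀ X : Set (BondConfig (Fin n)), MeasurableSet X := fun _ => MeasurableSet.of_discrete
  have iUb : IsUpperSet Ub := isUpperSet_openConnIn _ _ _
  have iUc : IsUpperSet Uc := isUpperSet_openConnIn _ _ _
  have iUy : IsUpperSet Uy := isUpperSet_openConnIn _ _ _
  have iVb : IsUpperSet Vb := isUpperSet_openConnIn _ _ _
  have iVc : IsUpperSet Vc := isUpperSet_openConnIn _ _ _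
  have iVy : IsUpperSet Vy := isUpperSet_openConnIn _ _ _
  have k1 := prodBernoulli_harris w iUb (iVc.inter iVy) (hm _) (hm _)
  have k2 := prodBernoulli_harris w iUc (iVb.inter iVy) (hm _) (hm _)
  have k3 := prodBernoulli_harris w iUy (iVb.inter iVc) (hm _) (hm _)
  have k4 := prodBernoulli_harris w iVb (iUc.inter iUy) (hm _) (hm _)
  have k5 := prodBernoulli_harris w iVc (iUb.inter iUy) (hm _) (hm _)
  have k6 := prodBernoulli_harris w iVy (iUb.inter iUc) (hm _) (hm _)
  have cnt := real_split_count w Ub Uc Uy Vb Vc Vy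
  have E : twoEdgeRF11 w s(s, u) s(s, v) (openConn s b) (openConn s c) (openConn s y) =
      2 * (prodBernoulli w).real ((Ub ∪ Vb) ∩ (Uc ∪ Vc) ∩ (Uy ∪ Vy))
        + 4 * (prodBernoulli w).real (Ub ∩ Uc ∩ Uy) + 4 * (prodBernoulli w).real (Vb ∩ Vc ∩ Vy)
        - ((prodBernoulli w).real Ub * (prodBernoulli w).real (Vc ∩ Vy)
            + (prodBernoulli w).real Vb * (prodBernoulli w).real (Uc ∩ Uy)
            + (prodBernoulli w).real Uc * (prodBernoulli w).real (Vb ∩ Vy)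
            + (prodBernoulli w).real Vc * (prodBernoulli w).real (Ub ∩ Uy)
            + (prodBernoulli w).real Uy * (prodBernoulli w).real (Vb ∩ Vc)
            + (prodBernoulli w).real Vy * (prodBernoulli w).real (Ub ∩ Uc)) := by
    simp only [twoEdgeRF11, trilin]
    rw [z1, z2, z3, z4, z5, z6, z7, a1, a2, a3, a4, a5, a6, a7, b1, b2, b3, b4, b5, b6, b7, m4]
    ring
  rw [E]
  linarith [k1, k2, k3, k4, k5, k6, cnt]

/-- **Degree-two root, with `RF11` discharged.**  As `incStar_nonneg_of_degTwoRoot`, without the hypothesis on the `(1,1)` fibre. [this work] -/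
theorem incStar_nonneg_of_degTwoRoot' (w : Sym2 (Fin n) → unitInterval) {s u v b c y : Fin n}
    (hus : u ≠ s) (hvs : v ≠ s) (huv : u ≠ v) (hb : b ≠ s) (hc : c ≠ s) (hy : y ≠ s)
    (hw : ∀ z : Fin n, z ≠ s → z ≠ u → z ≠ v → w s(s, z) = 0)
    (h03 : 0 ≤ sahiE3 (pin₂ w s(s, u) s(s, v) 0 1) (openConn s b) (openConn s c) (openConn s y))
    (h30 : 0 ≤ sahiE3 (pin₂ w s(s, u) s(s, v) 1 0) (openConn s b) (openConn s c) (openConn s y))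
    (h33 : 0 ≤ sahiE3 (pin₂ w s(s, u) s(s, v) 1 1) (openConn s b) (openConn s c) (openConn s y))
    (h13 : 0 ≤ polar₁ (pin₂ w s(s, u) s(s, v) 0 1) (pin₂ w s(s, u) s(s, v) 1 1) (openConn s b) (openConn s c) (openConn s y))
    (h23 : 0 ≤ polar₁ (pin₂ w s(s, u) s(s, v) 1 1) (pin₂ w s(s, u) s(s, v) 0 1) (openConn s b) (openConn s c) (openConn s y))
    (h31 : 0 ≤ polar₁ (pin₂ w s(s, u) s(s, v) 1 0) (pin₂ w s(s, u) s(s, v) 1 1) (openConn s b) (openConn s c) (openConn s y))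
    (h32 : 0 ≤ polar₁ (pin₂ w s(s, u) s(s, v) 1 1) (pin₂ w s(s, u) s(s, v) 1 0) (openConn s b) (openConn s c) (openConn s y))
    (h12 : 0 ≤ twoEdgeRF12 w s(s, u) s(s, v) (openConn s b) (openConn s c) (openConn s y))
    (h21 : 0 ≤ twoEdgeRF21 w s(s, u) s(s, v) (openConn s b) (openConn s c) (openConn s y))
    (h22 : 0 ≤ twoEdgeRF22 w s(s, u) s(s, v) (openConn s b) (openConn s c) (openConn s y)) :
    0 ≤ sahiE3 (prodBernoulli w) (openConn s b) (openConn s c) (openConn s y) :=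
  incStar_nonneg_of_degTwoRoot w hus huv hb hc hy hw h03 h30 h33 h13 h23 h31 h32
    (twoEdgeRF11_nonneg_of_degTwoRoot w hus hvs huv hb hc hy hw) h12 h21 h22


end IncStar

end Summit.CriticalPhenomena.PercolationContinuityZ3.Theorems

end
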